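import Summits.NavierStokesRegularity.NavierStokesRegularity.Theses.FilamentSkeletonRss
import Literature.Analysis.FluidPDE.GaussianVortexPlanarProofs
import Literature.Analysis.FluidPDE.GaussianVortexPlanarLinear
import Literature.Analysis.FluidPDE.BiotSavart2DSymmetry
import Literature.Analysis.FluidPDE.WholeSpaceIBP
import Literature.Geometry.Lorentzian.HarmonicallyFlatPotential
import Summits.AnomalousDissipation.AnomalousDissipation.Theorems.MarginalStabilityChainStretchedVortexRowsStubCellSolvabilityTools
import Summits.AnomalousDissipation.AnomalousDissipation.Theorems.MarginalStabilityChainStretchedVortexRowsStubCoreInverseIntegrabilityTools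

/-!
# Tools for stub `stub_classClosure` (crux `CoreLinearInvertibility`, stmt-NavierStokesRegularity-17973,
# route `FilamentSkeletonRss`, line `Sketch`) — part 2: calculus of `T_{λ,R}` and radial cut-offs

Log of attempts (worker W2 of the line lead): v1 = this decomposition (parts A–D + assembly).

The linearised strained planar core operator at the Gaussian core,
`T_{λ,R} w = L_λ w − R (⟪v^G, ∇w⟫ + ⟪K∗w, ∇G⟫)` (`L_λ = strainedVorticityOperator λ`,
`v^G = gaussVortexVelocity`, `K∗· = biotSavart2D`, `G = gaussVortexProfile`; written `T lam R w x`
through a section hypothesis `hT`, no new definition), and the facts the class-closure argument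
uses about it:

* linearity on `C²` functions whose Biot–Savart integrals converge absolutely (`coreOp_comb`),
  a.e. strong measurability of `T w` (`aestronglyMeasurable_coreOp`);
* the product rule
  `T(θw) = θ Tw + w (L_λθ − θ − R Dθ[v^G]) + 2 Σᵢ ∂ᵢθ ∂ᵢw − R ⟪K∗(θw) − θ K∗w, ∇G⟫` (`coreOp_mul`;
  Leibniz for the trace of the Hessian, tree `MetricCoord.sum_fderiv_fderiv_mul`);
* the radial cut-offs `χ_R = cutoff R` (tree `Literature/Analysis/FluidPDE/WholeSpaceIBP`):
  `Δ χ_R (x) = R⁻² (Δχ)(x/R)`, so `|Δχ_R| ≤ C` for `R ≥ 1`; `|x| ‖Dχ_R(x)‖ ≤ 2C`; and at every fixed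
  `x`, eventually `χ_R = 1` near `x`, hence `Dχ_R(x) = 0`, `Δχ_R(x) = 0`.

References: Th. Gallay, Y. Maekawa, arXiv:1610.08384, §4.1 (4.3) (the operator `L_λ`); folklore.
-/

set_option linter.dupNamespace false

noncomputable section

namespace Summit.NavierStokesRegularity.NavierStokesRegularity.Theorems

open Set Function Filter MeasureTheory Topology Metric
open Literature.Analysis Literature.Analysis.FluidPDE Literature.Geometry.Lorentzian
open Summit.AnomalousDissipation.AnomalousDissipation.Theorems.MarginalStabilityChainStretchedVortexRows
open scoped InnerProductSpace Laplacian ContDiff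

/-! ### Biot–Savart integrability bookkeeping and linearity -/

section BiotSavart

variable {a b : EuclideanSpace ℝ (Fin 2) → ℝ}

/-- Differences keep the Biot–Savart integrals absolutely convergent. [folklore] -/
theorem bsInt_sub (ha : ∀ x, Integrable (fun y => a y • biotSavartKernel2D (x - y)))
    (hb : ∀ x, Integrable (fun y => b y • biotSavartKernel2D (x - y))) (x : EuclideanSpace ℝ (Fin 2)) :
    Integrable (fun y => (a y - b y) • biotSavartKernel2D (x - y)) := by
  simp_rw [sub_smul]
  exact (ha x).sub (hb x)

/-- Scalar multiples keep the Biot–Savart integrals absolutely convergent. [folklore] -/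
theorem bsInt_const_mul (c : ℝ) (ha : ∀ x, Integrable (fun y => a y • biotSavartKernel2D (x - y)))
    (x : EuclideanSpace ℝ (Fin 2)) :
    Integrable (fun y => (c * a y) • biotSavartKernel2D (x - y)) := by
  simp_rw [mul_smul]
  exact (ha x).smul c

/-- A continuous compactly supported density has absolutely convergent Biot–Savart integrals
(tree `integrable_smul_biotSavartKernel2D`). [folklore] -/
theorem bsInt_of_hasCompactSupport (ha : Continuous a) (hac : HasCompactSupport a)
    (x : EuclideanSpace ℝ (Fin 2)) : Integrable (fun y => a y • biotSavartKernel2D (x - y)) := by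
  obtain ⟨C, hC⟩ := ha.bounded_above_of_compact_support hac
  exact integrable_smul_biotSavartKernel2D (ha.integrable_of_hasCompactSupport hac) (M := C)
    (fun y => by rw [← Real.norm_eq_abs]; exact hC y) x

/-- Multiplying the density by a continuous function with `|θ| ≤ 1` keeps the Biot–Savart
integrals absolutely convergent. [folklore] -/
theorem bsInt_mul_of_abs_le_one {θ : EuclideanSpace ℝ (Fin 2) → ℝ} (hθ : Continuous θ)
    (hθ1 : ∀ y, |θ y| ≤ 1) (ha : Continuous a)
    (haK : ∀ x, Integrable (fun y => a y • biotSavartKernel2D (x - y))) (x : EuclideanSpace ℝ (Fin 2)) :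
    Integrable (fun y => (θ y * a y) • biotSavartKernel2D (x - y)) := by
  refine (haK x).mono (((hθ.mul ha).measurable.smul
    (measurable_biotSavartKernel2D.comp (measurable_const.sub measurable_id))).aestronglyMeasurable)
    (Eventually.of_forall fun y => ?_)
  rw [norm_smul, norm_smul, Real.norm_eq_abs, Real.norm_eq_abs, abs_mul]
  calc |θ y| * |a y| * ‖biotSavartKernel2D (x - y)‖ ≤ 1 * |a y| * ‖biotSavartKernel2D (x - y)‖ := by
        gcongr; exact hθ1 y
    _ = |a y| * ‖biotSavartKernel2D (x - y)‖ := by rw [one_mul]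

/-- `K∗(a − b) = K∗a − K∗b` where both integrals converge absolutely. [folklore] -/
theorem biotSavart2D_sub (ha : ∀ x, Integrable (fun y => a y • biotSavartKernel2D (x - y)))
    (hb : ∀ x, Integrable (fun y => b y • biotSavartKernel2D (x - y))) (x : EuclideanSpace ℝ (Fin 2)) :
    biotSavart2D (fun y => a y - b y) x = biotSavart2D a x - biotSavart2D b x := by
  unfold biotSavart2D
  simp_rw [sub_smul]
  exact integral_sub (ha x) (hb x)

/-- `K∗(c a) = c K∗a`. [folklore] -/
theorem biotSavart2D_const_mul (c : ℝ) (a : EuclideanSpace ℝ (Fin 2) → ℝ) (x : EuclideanSpace ℝ (Fin 2)) :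
    biotSavart2D (fun y => c * a y) x = c • biotSavart2D a x := by
  unfold biotSavart2D
  simp_rw [mul_smul]
  exact integral_smul c _

end BiotSavart

/-! ### Linearity and the product rule for `T_{λ,R}` -/

section Linear

/-! In this section `T lam R w x` stands for the full operator
`T_{λ,R} w (x) = L_λ w (x) − R (⟪v^G(x), ∇w(x)⟫ + ⟪(K∗w)(x), ∇G(x)⟫)` through the hypothesis `hT`
(instantiate `T` with that expression and `hT := fun _ _ _ _ => rfl`; no new definition). -/

variable {lam R : ℝ} {T : ℝ → ℝ → (EuclideanSpace ℝ (Fin 2) → ℝ) → EuclideanSpace ℝ (Fin 2) → ℝ}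
  (hT : ∀ (lam R : ℝ) (w : EuclideanSpace ℝ (Fin 2) → ℝ) (x : EuclideanSpace ℝ (Fin 2)),
    T lam R w x = strainedVorticityOperator lam w x -
      R * (⟪gaussVortexVelocity x, gradient w x⟫_ℝ + ⟪biotSavart2D w x, gradient gaussVortexProfile x⟫_ℝ))

/-- `L_λ (a − b) = L_λ a − L_λ b` on `C²`. [folklore] -/
theorem strainedVorticityOperator_sub {a b : EuclideanSpace ℝ (Fin 2) → ℝ} (ha : ContDiff ℝ 2 a)
    (hb : ContDiff ℝ 2 b) (lam : ℝ) (x : EuclideanSpace ℝ (Fin 2)) :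
    strainedVorticityOperator lam (fun y => a y - b y) x =
      strainedVorticityOperator lam a x - strainedVorticityOperator lam b x := by
  have hΔ : Δ (fun y => a y - b y) x = Δ a x - Δ b x :=
    ContDiffAt.laplacian_sub (f₁ := a) (f₂ := b) ha.contDiffAt hb.contDiffAt
  simp only [strainedVorticityOperator, hΔ,
    fderiv_fun_sub (ha.differentiable two_ne_zero x) (hb.differentiable two_ne_zero x),
    _root_.sub_apply]
  ring

/-- `L_λ (c a) = c L_λ a` on `C²`. [folklore] -/
theorem strainedVorticityOperator_const_mul {a : EuclideanSpace ℝ (Fin 2) → ℝ} (ha : ContDiff ℝ 2 a)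
    (c lam : ℝ) (x : EuclideanSpace ℝ (Fin 2)) :
    strainedVorticityOperator lam (fun y => c * a y) x = c * strainedVorticityOperator lam a x := by
  have hΔ : Δ (fun y => c * a y) x = c * Δ a x := by
    have := InnerProductSpace.laplacian_smul (f := a) (x := x) c ha.contDiffAt
    simpa [Pi.smul_def, smul_eq_mul] using this
  have hD : fderiv ℝ (fun y => c * a y) x = c • fderiv ℝ a x :=
    ((ha.differentiable two_ne_zero x).hasFDerivAt.const_mul c).fderiv
  simp only [strainedVorticityOperator, hΔ, hD, _root_.FunLike.coe_smul, Pi.smul_apply,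
    smul_eq_mul]
  ring

include hT

/-- `T (a − b) = T a − T b` for `C²` densities with absolutely convergent Biot–Savart integrals.
[folklore] -/
theorem coreOp_sub {a b : EuclideanSpace ℝ (Fin 2) → ℝ} (ha : ContDiff ℝ 2 a) (hb : ContDiff ℝ 2 b)
    (haK : ∀ x, Integrable (fun y => a y • biotSavartKernel2D (x - y)))
    (hbK : ∀ x, Integrable (fun y => b y • biotSavartKernel2D (x - y))) (x : EuclideanSpace ℝ (Fin 2)) :
    T lam R (fun y => a y - b y) x = T lam R a x - T lam R b x := by
  have hgrad : gradient (fun y => a y - b y) x = gradient a x - gradient b x := by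
    simp only [gradient, fderiv_fun_sub (ha.differentiable two_ne_zero x)
      (hb.differentiable two_ne_zero x), map_sub]
  rw [hT, hT, hT, strainedVorticityOperator_sub ha hb, hgrad, biotSavart2D_sub haK hbK,
    inner_sub_right, inner_sub_left]
  ring

/-- `T (c a) = c T a`. [folklore] -/
theorem coreOp_const_mul {a : EuclideanSpace ℝ (Fin 2) → ℝ} (ha : ContDiff ℝ 2 a) (c : ℝ)
    (x : EuclideanSpace ℝ (Fin 2)) :
    T lam R (fun y => c * a y) x = c * T lam R a x := by
  have hgrad : gradient (fun y => c * a y) x = c • gradient a x := by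
    simp only [gradient, ((ha.differentiable two_ne_zero x).hasFDerivAt.const_mul c).fderiv, map_smul]
  rw [hT, hT, strainedVorticityOperator_const_mul ha, hgrad, biotSavart2D_const_mul,
    inner_smul_right, inner_smul_left]
  simp only [RCLike.conj_to_real]
  ring

/-- **Linearity of `T` on the moment-corrected cut-off**:
`T(u − m₀η₀ − m₁η₁ − m₂η₂) = Tu − m₀Tη₀ − m₁Tη₁ − m₂Tη₂`. [folklore] -/
theorem coreOp_comb {u η₀ η₁ η₂ : EuclideanSpace ℝ (Fin 2) → ℝ} (hu : ContDiff ℝ 2 u)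
    (h0 : ContDiff ℝ 2 η₀) (h1 : ContDiff ℝ 2 η₁) (h2 : ContDiff ℝ 2 η₂)
    (huK : ∀ x, Integrable (fun y => u y • biotSavartKernel2D (x - y)))
    (h0K : ∀ x, Integrable (fun y => η₀ y • biotSavartKernel2D (x - y)))
    (h1K : ∀ x, Integrable (fun y => η₁ y • biotSavartKernel2D (x - y)))
    (h2K : ∀ x, Integrable (fun y => η₂ y • biotSavartKernel2D (x - y))) (m₀ m₁ m₂ : ℝ)
    (x : EuclideanSpace ℝ (Fin 2)) :
    T lam R (fun y => u y - m₀ * η₀ y - m₁ * η₁ y - m₂ * η₂ y) x =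
      T lam R u x - m₀ * T lam R η₀ x - m₁ * T lam R η₁ x - m₂ * T lam R η₂ x := by
  have hA : ContDiff ℝ 2 (fun y => u y - m₀ * η₀ y) := hu.sub (contDiff_const.mul h0)
  have hB : ContDiff ℝ 2 (fun y => u y - m₀ * η₀ y - m₁ * η₁ y) := hA.sub (contDiff_const.mul h1)
  have hAK : ∀ x, Integrable (fun y => (u y - m₀ * η₀ y) • biotSavartKernel2D (x - y)) :=
    bsInt_sub huK (bsInt_const_mul m₀ h0K)
  have hBK : ∀ x, Integrable (fun y => (u y - m₀ * η₀ y - m₁ * η₁ y) • biotSavartKernel2D (x - y)) :=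
    bsInt_sub hAK (bsInt_const_mul m₁ h1K)
  rw [coreOp_sub hT hB (contDiff_const.mul h2) hBK (bsInt_const_mul m₂ h2K),
    coreOp_sub hT hA (contDiff_const.mul h1) hAK (bsInt_const_mul m₁ h1K),
    coreOp_sub hT hu (contDiff_const.mul h0) huK (bsInt_const_mul m₀ h0K),
    coreOp_const_mul hT h0, coreOp_const_mul hT h1, coreOp_const_mul hT h2]

omit hT in
/-- **Leibniz rule for `L_λ`**: `L_λ(θw) = θ L_λ w + w (L_λ θ − θ) + 2 Σᵢ ∂ᵢθ ∂ᵢw`. [folklore] -/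
theorem strainedVorticityOperator_mul {θ w : EuclideanSpace ℝ (Fin 2) → ℝ} (hθ : ContDiff ℝ 2 θ)
    (hw : ContDiff ℝ 2 w) (lam : ℝ) (x : EuclideanSpace ℝ (Fin 2)) :
    strainedVorticityOperator lam (fun y => θ y * w y) x =
      θ x * strainedVorticityOperator lam w x + w x * (strainedVorticityOperator lam θ x - θ x) +
        2 * ∑ i, fderiv ℝ θ x (EuclideanSpace.basisFun (Fin 2) ℝ i) *
          fderiv ℝ w x (EuclideanSpace.basisFun (Fin 2) ℝ i) := by
  have hΔ := MetricCoord.sum_fderiv_fderiv_mul (⇑(EuclideanSpace.basisFun (Fin 2) ℝ))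
    (hθ.contDiffAt (x := x)) (hw.contDiffAt (x := x))
  rw [strainedVorticityOperator, strainedVorticityOperator, strainedVorticityOperator,
    MetricCoord.laplacian_apply_eq_sum (EuclideanSpace.basisFun (Fin 2) ℝ) (fun y => θ y * w y),
    MetricCoord.laplacian_apply_eq_sum (EuclideanSpace.basisFun (Fin 2) ℝ) w,
    MetricCoord.laplacian_apply_eq_sum (EuclideanSpace.basisFun (Fin 2) ℝ) θ, hΔ,
    fderiv_fun_mul (hθ.differentiable two_ne_zero x) (hw.differentiable two_ne_zero x)]
  simp only [_root_.add_apply, _root_.FunLike.coe_smul, Pi.smul_apply, smul_eq_mul]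
  ring

/-- **Leibniz rule for `T_{λ,R}`**:
`T(θw) = θ Tw + w (L_λθ − θ − R Dθ[v^G]) + 2 Σᵢ ∂ᵢθ ∂ᵢw − R ⟪K∗(θw) − θ K∗w, ∇G⟫`
(the last inner product is the nonlocal commutator). [folklore] -/
theorem coreOp_mul {θ w : EuclideanSpace ℝ (Fin 2) → ℝ} (hθ : ContDiff ℝ 2 θ) (hw : ContDiff ℝ 2 w)
    (x : EuclideanSpace ℝ (Fin 2)) :
    T lam R (fun y => θ y * w y) x =
      θ x * T lam R w x +
        w x * (strainedVorticityOperator lam θ x - θ x - R * fderiv ℝ θ x (gaussVortexVelocity x)) +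
        2 * ∑ i, fderiv ℝ θ x (EuclideanSpace.basisFun (Fin 2) ℝ i) *
          fderiv ℝ w x (EuclideanSpace.basisFun (Fin 2) ℝ i) -
        R * ⟪biotSavart2D (fun y => θ y * w y) x - θ x • biotSavart2D w x,
          gradient gaussVortexProfile x⟫_ℝ := by
  rw [hT, hT, strainedVorticityOperator_mul hθ hw,
    real_inner_gradient_right (fun y => θ y * w y) x (gaussVortexVelocity x),
    real_inner_gradient_right w x (gaussVortexVelocity x),
    fderiv_fun_mul (hθ.differentiable two_ne_zero x) (hw.differentiable two_ne_zero x),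
    inner_sub_left, inner_smul_left]
  simp only [_root_.add_apply, _root_.FunLike.coe_smul, Pi.smul_apply, smul_eq_mul,
    RCLike.conj_to_real]
  ring

/-- `T w` is a.e. strongly measurable for `w ∈ C²` (local part continuous, nonlocal part a
parametric Bochner integral). [folklore] -/
theorem aestronglyMeasurable_coreOp {w : EuclideanSpace ℝ (Fin 2) → ℝ} (hw : ContDiff ℝ 2 w) :
    AEStronglyMeasurable (T lam R w) volume := by
  have h : T lam R w = fun x => strainedVorticityOperator lam w x -
      R * (⟪gaussVortexVelocity x, gradient w x⟫_ℝ + ⟪biotSavart2D w x, gradient gaussVortexProfile x⟫_ℝ) :=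
    funext (hT lam R w)
  rw [h]
  exact (continuous_strainedVorticityOperator hw lam).aestronglyMeasurable.sub
    (((continuous_gaussVortexVelocity.inner (continuous_gradient_of_contDiff (hw.of_le one_le_two))
      ).aestronglyMeasurable.add ((stronglyMeasurable_biotSavart2D hw.continuous.measurable
      ).aestronglyMeasurable.inner (continuous_gradient_of_contDiff
        (contDiff_gaussVortexProfile (n := 1))).aestronglyMeasurable)).const_mul R)

end Linear

/-! ### Radial cut-offs `χ_R = cutoff R` -/

section Cutoff

/-- **`Δ χ_R (x) = R⁻² (Δχ)(R⁻¹x)`** for `χ_R = cutoff R = χ(R⁻¹·)`, `χ = dyadicCutoff ℝ²`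
(chain rule twice, `Dχ_R = R⁻¹ Dχ(R⁻¹·)`). [folklore] -/
theorem laplacian_cutoff (R : ℝ) (x : EuclideanSpace ℝ (Fin 2)) :
    Δ (cutoff (E := EuclideanSpace ℝ (Fin 2)) R) x =
      R⁻¹ ^ 2 * Δ (fun y => FunctionSpaces.dyadicCutoff (EuclideanSpace ℝ (Fin 2)) y) (R⁻¹ • x) := by
  set χ : EuclideanSpace ℝ (Fin 2) → ℝ := fun y => FunctionSpaces.dyadicCutoff (EuclideanSpace ℝ (Fin 2)) y
    with hχdef
  have hχ : ContDiff ℝ ∞ χ := (FunctionSpaces.dyadicCutoff (EuclideanSpace ℝ (Fin 2))).contDiff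
  have h1 : fderiv ℝ (cutoff (E := EuclideanSpace ℝ (Fin 2)) R) = fun y => R⁻¹ • fderiv ℝ χ (R⁻¹ • y) := by
    funext y
    exact fderiv_comp_smul (f := χ) R⁻¹
  have hdiff : Differentiable ℝ (fderiv ℝ χ) :=
    (hχ.fderiv_right (m := 1) (by norm_cast)).differentiable one_ne_zero
  have hd : ∀ y : EuclideanSpace ℝ (Fin 2), DifferentiableAt ℝ (fun z => fderiv ℝ χ (R⁻¹ • z)) y :=
    fun y => (hdiff (R⁻¹ • y)).comp y (differentiableAt_id.const_smul R⁻¹)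
  have h2 : fderiv ℝ (fderiv ℝ (cutoff (E := EuclideanSpace ℝ (Fin 2)) R)) x =
      R⁻¹ • (R⁻¹ • fderiv ℝ (fderiv ℝ χ) (R⁻¹ • x)) := by
    rw [h1, fderiv_fun_const_smul (hd x), fderiv_comp_smul (f := fderiv ℝ χ) R⁻¹]
  rw [MetricCoord.laplacian_apply_eq_sum (EuclideanSpace.basisFun (Fin 2) ℝ),
    MetricCoord.laplacian_apply_eq_sum (EuclideanSpace.basisFun (Fin 2) ℝ), h2, Finset.mul_sum]
  refine Finset.sum_congr rfl fun i _ => ?_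
  simp only [_root_.smul_apply, smul_eq_mul]
  ring

/-- **`|Δ χ_R| ≤ C` uniformly in `R ≥ 1`.** [folklore] -/
theorem exists_abs_laplacian_cutoff_le :
    ∃ C : ℝ, ∀ R : ℝ, 1 ≤ R → ∀ x : EuclideanSpace ℝ (Fin 2),
      |Δ (cutoff (E := EuclideanSpace ℝ (Fin 2)) R) x| ≤ C := by
  set χ : EuclideanSpace ℝ (Fin 2) → ℝ := fun y => FunctionSpaces.dyadicCutoff (EuclideanSpace ℝ (Fin 2)) y
    with hχdef
  have hχ : ContDiff ℝ ∞ χ := (FunctionSpaces.dyadicCutoff (EuclideanSpace ℝ (Fin 2))).contDiff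
  have hχc : HasCompactSupport χ := (FunctionSpaces.dyadicCutoff (EuclideanSpace ℝ (Fin 2))).hasCompactSupport
  obtain ⟨C, hC⟩ := (continuous_laplacian_fin_two hχ).bounded_above_of_compact_support
    (hasCompactSupport_laplacian_fin_two hχ hχc)
  refine ⟨C, fun R hR x => ?_⟩
  rw [laplacian_cutoff, abs_mul]
  have h0 : 0 < R := by linarith
  have h1 : |R⁻¹ ^ 2| ≤ 1 := by
    rw [abs_of_nonneg (by positivity)]
    exact pow_le_one₀ (by positivity) (inv_le_one_of_one_le₀ hR)
  have h2 : |Δ χ (R⁻¹ • x)| ≤ C := by simpa [Real.norm_eq_abs] using hC (R⁻¹ • x)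
  calc |R⁻¹ ^ 2| * |Δ χ (R⁻¹ • x)| ≤ 1 * C := mul_le_mul h1 h2 (abs_nonneg _) zero_le_one
    _ = C := one_mul C

variable {R : ℝ} {x : EuclideanSpace ℝ (Fin 2)}

/-- Near a point with `‖x‖ < R`, the cut-off `χ_R` is identically `1`. [folklore] -/
theorem cutoff_eventuallyEq_one (hR : 0 < R) (hx : ‖x‖ < R) :
    (cutoff (E := EuclideanSpace ℝ (Fin 2)) R) =ᶠ[𝓝 x] fun _ => 1 := by
  have hopen : IsOpen {y : EuclideanSpace ℝ (Fin 2) | ‖y‖ < R} := isOpen_lt continuous_norm continuous_const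
  filter_upwards [hopen.mem_nhds hx] with y hy
  exact cutoff_eq_one hR (le_of_lt hy)

/-- `Dχ_R(x) = 0` for `‖x‖ < R`. [folklore] -/
theorem fderiv_cutoff_eq_zero_of_norm_lt (hR : 0 < R) (hx : ‖x‖ < R) :
    fderiv ℝ (cutoff (E := EuclideanSpace ℝ (Fin 2)) R) x = 0 := by
  rw [(cutoff_eventuallyEq_one hR hx).fderiv_eq]
  simp

/-- `Δχ_R(x) = 0` for `‖x‖ < R`. [folklore] -/
theorem laplacian_cutoff_eq_zero_of_norm_lt (hR : 0 < R) (hx : ‖x‖ < R) :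
    Δ (cutoff (E := EuclideanSpace ℝ (Fin 2)) R) x = 0 := by
  rw [(InnerProductSpace.laplacian_congr_nhds (cutoff_eventuallyEq_one hR hx)).eq_of_nhds]
  simp [InnerProductSpace.laplacian_const]

/-- `Dχ_R(x) = 0` for `‖x‖ > 2R`. [folklore] -/
theorem fderiv_cutoff_eq_zero_of_lt_norm (hR : 0 < R) (hx : 2 * R < ‖x‖) :
    fderiv ℝ (cutoff (E := EuclideanSpace ℝ (Fin 2)) R) x = 0 := by
  have h : (cutoff (E := EuclideanSpace ℝ (Fin 2)) R) =ᶠ[𝓝 x] fun _ => 0 := by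
    have hopen : IsOpen {y : EuclideanSpace ℝ (Fin 2) | 2 * R < ‖y‖} :=
      isOpen_lt continuous_const continuous_norm
    filter_upwards [hopen.mem_nhds hx] with y hy
    exact cutoff_eq_zero hR hy.le
  rw [h.fderiv_eq]
  simp

/-- **The drift coefficient is bounded**: `‖x‖ ‖Dχ_R(x)‖ ≤ 2C` given `‖Dχ_R‖ ≤ C/R`
(`Dχ_R = 0` off the disc of radius `2R`). [folklore] -/
theorem norm_mul_norm_fderiv_cutoff_le {C : ℝ}
    (hC : ∀ R : ℝ, 0 < R → ∀ x : EuclideanSpace ℝ (Fin 2), ‖fderiv ℝ (cutoff R) x‖ ≤ C / R)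
    (hR : 0 < R) (x : EuclideanSpace ℝ (Fin 2)) :
    ‖x‖ * ‖fderiv ℝ (cutoff R) x‖ ≤ 2 * C := by
  have hC0 : 0 ≤ C := by
    have h := (norm_nonneg _).trans (hC R hR x)
    exact (div_nonneg_iff.1 h).elim (fun h => h.1) fun h => absurd h.2 (not_le.2 hR)
  by_cases hx : 2 * R < ‖x‖
  · rw [fderiv_cutoff_eq_zero_of_lt_norm hR hx, norm_zero, mul_zero]
    positivity
  · rw [not_lt] at hx
    calc ‖x‖ * ‖fderiv ℝ (cutoff R) x‖ ≤ (2 * R) * (C / R) :=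
          mul_le_mul hx (hC R hR x) (norm_nonneg _) (by positivity)
      _ = 2 * C := by field_simp

/-- Along `R = k + 1`, at every fixed `x` the cut-off is eventually `1` near `x`. [folklore] -/
theorem eventually_cutoff_natCast_eventuallyEq_one (x : EuclideanSpace ℝ (Fin 2)) :
    ∀ᶠ k : ℕ in atTop, (cutoff (E := EuclideanSpace ℝ (Fin 2)) ((k : ℝ) + 1)) =ᶠ[𝓝 x] fun _ => 1 := by
  have ht : Tendsto (fun k : ℕ => (k : ℝ) + 1) atTop atTop :=
    tendsto_natCast_atTop_atTop.atTop_add tendsto_const_nhds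
  filter_upwards [ht.eventually_gt_atTop ‖x‖] with k hk
  exact cutoff_eventuallyEq_one (by positivity) hk

/-- `|χ − 1| ≤ 1` for the cut-off. [folklore] -/
theorem abs_cutoff_sub_one_le (r : ℝ) (x : EuclideanSpace ℝ (Fin 2)) : |cutoff r x - 1| ≤ 1 := by
  rw [abs_sub_comm, abs_of_nonneg (by linarith [cutoff_le_one r x])]
  linarith [cutoff_nonneg r x]

end Cutoff


/-- **Registered tools stub `stub_classClosureToolsC`** (helpers for `stub_classClosure`, line
`Sketch` of crux `CoreLinearInvertibility`, stmt-NavierStokesRegularity-17973): the Leibniz rule for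
`L_λ`, the scaling law `Δχ_R = R⁻²(Δχ)(R⁻¹·)` of the radial cut-offs and the uniform bound on
`Δχ_R`. [folklore] -/
theorem stub_classClosureToolsC :
    (∀ (θ w : EuclideanSpace ℝ (Fin 2) → ℝ) (lam : ℝ) (x : EuclideanSpace ℝ (Fin 2)), ContDiff ℝ 2 θ →
      ContDiff ℝ 2 w →
      strainedVorticityOperator lam (fun y => θ y * w y) x =
        θ x * strainedVorticityOperator lam w x + w x * (strainedVorticityOperator lam θ x - θ x) +
          2 * ∑ i, fderiv ℝ θ x (EuclideanSpace.basisFun (Fin 2) ℝ i) *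
            fderiv ℝ w x (EuclideanSpace.basisFun (Fin 2) ℝ i)) ∧
    (∀ (R : ℝ) (x : EuclideanSpace ℝ (Fin 2)), Δ (cutoff (E := EuclideanSpace ℝ (Fin 2)) R) x =
      R⁻¹ ^ 2 * Δ (fun y => FunctionSpaces.dyadicCutoff (EuclideanSpace ℝ (Fin 2)) y) (R⁻¹ • x)) ∧
    (∃ C : ℝ, ∀ R : ℝ, 1 ≤ R → ∀ x : EuclideanSpace ℝ (Fin 2),
      |Δ (cutoff (E := EuclideanSpace ℝ (Fin 2)) R) x| ≤ C) :=
  ⟨fun _ _ lam x hθ hw => strainedVorticityOperator_mul hθ hw lam x, laplacian_cutoff,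
    exists_abs_laplacian_cutoff_le⟩

end Summit.NavierStokesRegularity.NavierStokesRegularity.Theorems
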